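import Literature.MathematicalPhysics.QuantumFieldTheory.Balaban1983to89.B8Eq191FlatDirichletWall
import Literature.MathematicalPhysics.QuantumFieldTheory.Balaban1983to89.B8CubeMemberBoxRows

/-!
# `Balaban1983to89.B8Eq1101CubeMemberCutoffs` — the PARTITION OF UNITY and the WALL of the two-region parametrix for [Balaban1985RegularSpaces] (1.101)
# at `U₀ = 1` on the cube member `{□_j}` of (1.131): ramps of the depth into `□₁`, supports, plateaus, Lipschitz bounds, and the wall site set with its
# tower structure ([Balaban1984PropagatorsII] (2.47)–(2.48) p. 231 «functions h_□, h̃_□ … h̃_□h_□ = h_□ … |∂h| ≤ O(1)(ML^jη)^{−1}»)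

statement-level skeleton of published theorems with citation tags; proofs where landed; nothing here is a claim about the
Yang–Mills mass gap

`[Balaban1985RegularSpaces]` ("B8", CMP **99** (1985) 75–102) (1.101) p. 93, p. 98 (cube family, collars `R₁M₁Lʲη`), (1.131) p. 99;
`[Balaban1984PropagatorsII]` ("B6", CMP **96** (1984) 223–250) (2.46)–(2.48) p. 231 (generalized cubes, the partition of unity `h_□`, `h̃_□`, their
gradient bounds), (2.49)–(2.58) p. 231–233 (the random-walk ∕ parametrix expansion).  PDF held: `paper:balaban1985-cmp99-regular-spaces-gauge-fixing`.

CITATION HEADER (lean-in-tree rule).  Cell `pub-ymgap` (YM Track A, HUMAN RULING D-0062), DAG node N05 = [B8], seat `pub-ymgap-dag-n05-c` (g9; (R1′)-v2 HYBRID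
route for REAL-1 = (1.101) of `B8Prop6CubeMemberFlatScalar.prop6_cubeMember_flat_of_real`, file F4a).  F1 `B8CubeMemberBoxDomains` (p537372), F2 `B8CubeMemberBoxRows`
(p538473), F3 `B8Eq191FlatDirichletWall` (p539587) supply region A (p21's Neumann box, levels `1 … n`, r05's hypothesis-free (1.101)), the row dictionary,
and the wall estimate.  THIS FILE fixes the GEOMETRY OF THE GLUING — print's partition of unity specialised to TWO regions: `h_A` supported inside `□₁`
(depth into `□₁` at least `2s`), `h_B = 1 − h_A` on `□₀`, the enlarged cutoffs `h̃_A`, `h̃_B` (`h̃h = h`), all `1∕s`-Lipschitz in the `ℓ¹` distance, and the WALL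
`W` = the level-0 collar `□₀ ∖ □₁` plus the whole `L`-blocks of `□₁` containing a site of depth `≤ m_W` — together with the facts the parametrix file needs:
supports and plateaus by depth, the wall is block-whole, lies outside `□₂` when `m_W + d(L−1) ≤ ρL`, hence carries the cube member's towers with levels `≤ 1`
(the hypotheses `hfull ∕ hdisj ∕ hcover ∕ hlow` of F3), and the `K`-row of a site of depth `≤ m_W − 1` sees only wall sites.

WHAT THIS FILE PROVES (kernel-checked; generic dimension `d ≥ 1`; cube datum `(L, a, M, ρ, k)` of `B8Eq131Cubes`; depth `depth … 1` into `□₁` of this base's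
g8 file `B8Eq191FlatDirichletDepth`; ramp length `s ≥ 1`; wall parameter `m_W`).
* §1 `ramp` (`0` below `0`, slope `1∕s`, `1` above `s`): `ramp_mem`, `ramp_of_nonpos`, `ramp_of_le`, `abs_ramp_sub_ramp_le` (`1∕s`-Lipschitz).
* §2 ★ `abs_depth_sub_le_l1dist` (the depth is `1`-Lipschitz for `|·|₁`, by induction on the distance from the one-step bound `abs_depth_sub_depth_le_one`),
  `l1dist_le_of_blockMap_eq` (sites of one `b`-block are `ℓ¹`-close: `≤ d(b−1)`).
* §3 `cutA = h_A`, `cutAt = h̃_A`, `cutB = h_B`, `cutBt = h̃_B` (defs) with `cut_mem` (values in `[0,1]`), ★ `cutAt_mul_cutA` ∕ `cutBt_mul_cutB` (`h̃h = h`),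
  ★ `cutA_add_cutB` (`h_A + h_B = 1` on `□₀`), `cut_eq_zero_of_not_mem`, `depth_of_cutAt_ne_zero` (`h̃_A ≠ 0 ⇒` depth `≥ s + 1`, the site and its neighbours in
  `□₁`), `cutAt_eq_of_depth` ∕ `cutA_eq_of_depth` ∕ `cutBt_facts` (plateaus by depth), ★ `cut_lipschitz` (`|h(z) − h(x)| ≤ |z − x|₁∕s`).
* §4 `wall` (def) with `wall_subset`, `mem_wall_of_depth_le`, `mem_wall_of_not_mem`, `depth_le_of_mem_wall` (`≤ m_W + d(L−1)` inside `□₁`),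
  `mem_wall_of_blockMap_eq` (block-whole), ★ `not_mem_cube_two_of_mem_wall` (`W ∩ □₂ = ∅` if `m_W + d(L−1) ≤ ρL`).
* §5 ★ `wall_level_le_one`, `wall_hfull`, `wall_hdisj`, `wall_hcover`, `wall_hlow` (the four hypotheses of `B8Eq191FlatDirichletWall.wall_green_decay` ∕
  `wall_rowBound` at `W`, `Λs = cubeLamS … n`), ★ `wall_row` (a site of depth `≤ m_W − 1`: it, its `□₀`-neighbours and its live tower block lie in `W`).

HONEST SCOPE ∕ NOT CLAIMED.  Lattice geometry only; no estimate.  Print's expansion uses a partition of unity over all generalized cubes of all levels; here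
only the split «deep region of `□₁`» ∕ «wall» is needed because the deep region is served in one piece by p21's Neumann-box chain (F1).  The ramps are
piecewise linear in the sup-depth, not print's smooth `h_□`; only boundedness, `h̃h = h`, `Σh = 1` and the Lipschitz bound are used downstream.
Count-neutral; N05 NOT discharged; one finite `T⁴` programme at fixed `ε`, Bałaban as printed; nothing continuum ∕ ℝ⁴ ∕ OS ∕ mass-gap ∕ Clay.  No `sorry`,
no `instance`, no `notation`; six `def`s (`ramp`, `cutA`, `cutAt`, `cutB`, `cutBt`, `wall`).  Unit `pub-ymgap-dag-n05-c` (g9), 2026-08-27.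

RELATED IN THE TREE, NOT DUPLICATED: `B8Eq191FlatDirichletDepth.*` (depth, USED), `B8Eq191FlatDirichletWall.*` (F3, USED), `B8CubeMemberBoxRows.*` (F2, imported for
the successor), `B8Eq191FlatDirichletCoercive.towerBlock_subset_cube` ∕ `…LettersCubeMember.towers_disjoint_cube` ∕ `…Conjugation.cover_cubeMember` (USED),
`B6IMSTermsKLevelV1` ∕ `B6CutoffSupportKLevelV1` (the torus lineage's cutoffs for [B6] (2.47) on p21's `V1` carriers — a different carrier and a full multi-cube
partition; not usable on the Dirichlet cube member).
-/
noncomputable section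

namespace Literature.MathematicalPhysics.QuantumFieldTheory.Balaban1983to89.B8Eq1101CubeMemberCutoffs

open B7Prop1Explicit (e)
open B7Prop1Local (InBox)
open B8Eq131Cubes (l1dist cube)
open B8Eq191FlatDirichletDepth (depth loC hiC fm mem_cube_iff_inBox mem_cube_iff_one_le_depth abs_depth_sub_depth_le_one depth_ge_of_mem_inner
  depth_nonneg)
open B8Eq191FlatDirichletWall (l1dist_self l1dist_nonneg abs_l1dist_step_le)
open Literature.MathematicalPhysics.QuantumLattice (blockMap)

variable {d : ℕ}

/-! ## §1 The ramp -/

/-- The ramp of length `s`: `0` up to `0`, linear with slope `1∕s`, `1` from `s` on. [cite: Balaban1984PropagatorsII, (2.47)–(2.48) p.231 («functions h_□ … |∂h| ≤ O(1)(ML^jη)^{−1}»)] -/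
def ramp (s : ℕ) (t : ℤ) : ℝ := max 0 (min 1 ((t : ℝ) / s))

/-- `0 ≤ ramp ≤ 1`. [cite: Balaban1984PropagatorsII, (2.47) p.231] -/
theorem ramp_mem (s : ℕ) (t : ℤ) : 0 ≤ ramp s t ∧ ramp s t ≤ 1 :=
  ⟨le_max_left _ _, max_le zero_le_one (min_le_left _ _)⟩

/-- `ramp = 0` below `0`. [cite: Balaban1984PropagatorsII, (2.47) p.231] -/
theorem ramp_of_nonpos {s : ℕ} (hs : 1 ≤ s) {t : ℤ} (ht : t ≤ 0) : ramp s t = 0 := by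
  have h : (t : ℝ) / s ≤ 0 := div_nonpos_of_nonpos_of_nonneg (by exact_mod_cast ht) (by positivity)
  unfold ramp
  exact max_eq_left (le_trans (min_le_right _ _) h)

/-- `ramp = 1` above `s`. [cite: Balaban1984PropagatorsII, (2.47) p.231] -/
theorem ramp_of_le {s : ℕ} (hs : 1 ≤ s) {t : ℤ} (ht : (s : ℤ) ≤ t) : ramp s t = 1 := by
  have hs0 : (0 : ℝ) < s := by exact_mod_cast hs
  have h : (1 : ℝ) ≤ (t : ℝ) / s := by rw [le_div_iff₀ hs0, one_mul]; exact_mod_cast ht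
  unfold ramp
  rw [min_eq_left h, max_eq_right zero_le_one]

/-- The ramp is `1∕s`-Lipschitz. [cite: Balaban1984PropagatorsII, (2.48) p.231] -/
theorem abs_ramp_sub_ramp_le {s : ℕ} (hs : 1 ≤ s) (t t' : ℤ) : |ramp s t - ramp s t'| ≤ |((t : ℝ) - t')| / s := by
  have hs0 : (0 : ℝ) < s := by exact_mod_cast hs
  unfold ramp
  rw [max_comm (0 : ℝ), max_comm (0 : ℝ)]
  calc |max (min 1 ((t : ℝ) / s)) 0 - max (min 1 ((t' : ℝ) / s)) 0|
      ≤ |min 1 ((t : ℝ) / s) - min 1 ((t' : ℝ) / s)| := abs_max_sub_max_le_abs _ _ _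
    _ ≤ |(t : ℝ) / s - (t' : ℝ) / s| := abs_min_sub_min_le_max _ _ _ _ |>.trans (by
        rw [sub_self, abs_zero, max_eq_right (abs_nonneg _)])
    _ = |((t : ℝ) - t')| / s := by rw [← sub_div, abs_div, abs_of_pos hs0]

/-! ## §2 The depth into `□₁` is `ℓ¹`-Lipschitz -/

/-- One step back: `|depth (z − e_μ) − depth z| ≤ 1`. [cite: Balaban1984PropagatorsII, (2.46) p.231] -/
theorem abs_depth_sub_step_le (hd : 0 < d) (L : ℕ) (a : Fin d → ℤ) (M ρ k j : ℕ) (z : Fin d → ℤ) (μ : Fin d) :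
    |depth hd L a M ρ k j (z + e μ) - depth hd L a M ρ k j z| ≤ 1 ∧ |depth hd L a M ρ k j (z - e μ) - depth hd L a M ρ k j z| ≤ 1 := by
  refine ⟨abs_depth_sub_depth_le_one hd L a M ρ k j z μ, ?_⟩
  have h := abs_depth_sub_depth_le_one hd L a M ρ k j (z - e μ) μ
  rw [sub_add_cancel] at h
  rwa [abs_sub_comm] at h

/-- **The depth is `1`-Lipschitz for the `ℓ¹` distance**: `|depth z − depth x| ≤ |z − x|₁`. [cite: Balaban1984PropagatorsII, (2.46) p.231] -/
theorem abs_depth_sub_le_l1dist (hd : 0 < d) (L : ℕ) (a : Fin d → ℤ) (M ρ k j : ℕ) (z x : Fin d → ℤ) :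
    |depth hd L a M ρ k j z - depth hd L a M ρ k j x| ≤ l1dist z x := by
  -- induction on the `ℓ¹` distance
  suffices h : ∀ (N : ℕ) (z x : Fin d → ℤ), l1dist z x = N → |depth hd L a M ρ k j z - depth hd L a M ρ k j x| ≤ l1dist z x by
    exact h (l1dist z x).toNat z x (Int.toNat_of_nonneg (l1dist_nonneg z x)).symm
  intro N
  induction N with
  | zero =>
    intro z x h0
    have hzx : z = x := by
      funext i
      have h1 : |z i - x i| = 0 := by
        have hle : |z i - x i| ≤ l1dist z x := by
          unfold l1dist; exact Finset.single_le_sum (f := fun i => |z i - x i|) (fun i _ => abs_nonneg _) (Finset.mem_univ i)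
        have := abs_nonneg (z i - x i)
        push_cast at h0
        linarith
      linarith [abs_eq_zero.mp h1, sub_eq_zero.mp (abs_eq_zero.mp h1)]
    subst hzx
    rw [sub_self, abs_zero]; exact l1dist_nonneg _ _
  | succ N ih =>
    intro z x hN
    -- pick a coordinate where `z ≠ x` and step towards `x`
    have hpos : 0 < l1dist z x := by rw [hN]; positivity
    obtain ⟨i, hi⟩ : ∃ i, z i ≠ x i := by
      by_contra hcon
      push Not at hcon
      have : l1dist z x = 0 := by unfold l1dist; exact Finset.sum_eq_zero fun i _ => by rw [hcon i, sub_self, abs_zero]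
      omega
    -- the step: `z' = z ∓ e_i` has `l1dist z' x = N` and is one step from `z`
    rcases lt_or_gt_of_ne hi with hlt | hgt
    · -- `z i < x i`: move up
      have hstep : l1dist (z + e i) x = N := by
        have key : l1dist (z + e i) x = l1dist z x - 1 := by
          unfold l1dist
          rw [← Finset.sum_erase_add _ _ (Finset.mem_univ i), ← Finset.sum_erase_add (Finset.univ) (fun i => |z i - x i|) (Finset.mem_univ i)]
          have hrest : ∑ j ∈ Finset.univ.erase i, |(z + e i) j - x j| = ∑ j ∈ Finset.univ.erase i, |z j - x j| :=
            Finset.sum_congr rfl fun j hj => by rw [Finset.mem_erase] at hj; simp [e, Pi.single_eq_of_ne hj.1]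
          rw [hrest]
          have h1 : |(z + e i) i - x i| = |z i - x i| - 1 := by
            simp only [Pi.add_apply, e, Pi.single_eq_same]
            rw [abs_of_nonpos (by omega), abs_of_neg (by omega)]; ring
          rw [h1]; ring
        rw [key, hN]; push_cast; ring
      have h1 := ih (z + e i) x hstep
      have h2 := (abs_depth_sub_step_le hd L a M ρ k j z i).1
      have htri := abs_sub_le (depth hd L a M ρ k j z) (depth hd L a M ρ k j (z + e i)) (depth hd L a M ρ k j x)
      rw [abs_sub_comm] at h2
      have : (l1dist (z + e i) x : ℤ) = l1dist z x - 1 := by rw [hstep, hN]; push_cast; ring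
      linarith
    · -- `x i < z i`: move down
      have hstep : l1dist (z - e i) x = N := by
        have key : l1dist (z - e i) x = l1dist z x - 1 := by
          unfold l1dist
          rw [← Finset.sum_erase_add _ _ (Finset.mem_univ i), ← Finset.sum_erase_add (Finset.univ) (fun i => |z i - x i|) (Finset.mem_univ i)]
          have hrest : ∑ j ∈ Finset.univ.erase i, |(z - e i) j - x j| = ∑ j ∈ Finset.univ.erase i, |z j - x j| :=
            Finset.sum_congr rfl fun j hj => by rw [Finset.mem_erase] at hj; simp [e, Pi.single_eq_of_ne hj.1]
          rw [hrest]
          have h1 : |(z - e i) i - x i| = |z i - x i| - 1 := by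
            simp only [Pi.sub_apply, e, Pi.single_eq_same]
            rw [abs_of_nonneg (by omega), abs_of_pos (by omega)]; ring
          rw [h1]; ring
        rw [key, hN]; push_cast; ring
      have h1 := ih (z - e i) x hstep
      have h2 := (abs_depth_sub_step_le hd L a M ρ k j z i).2
      have htri := abs_sub_le (depth hd L a M ρ k j z) (depth hd L a M ρ k j (z - e i)) (depth hd L a M ρ k j x)
      rw [abs_sub_comm] at h2
      have : (l1dist (z - e i) x : ℤ) = l1dist z x - 1 := by rw [hstep, hN]; push_cast; ring
      linarith

/-- Sites of one `b`-block are at `ℓ¹` distance `≤ d(b − 1)`. [folklore] [cite: Balaban1984PropagatorsII, (2.46) p.231] -/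
theorem l1dist_le_of_blockMap_eq {b : ℕ} (hb : 1 ≤ b) {z x : Fin d → ℤ} (h : blockMap b z = blockMap b x) :
    l1dist z x ≤ (d : ℤ) * (b - 1) := by
  have hb0 : (0 : ℤ) < b := by exact_mod_cast hb
  have hco : ∀ i, |z i - x i| ≤ (b : ℤ) - 1 := by
    intro i
    have hi : z i / (b : ℤ) = x i / (b : ℤ) := by
      have := congrFun h i; simpa [blockMap] using this
    have hz1 := Int.emod_add_ediv_mul (z i) (b : ℤ)
    have hx1 := Int.emod_add_ediv_mul (x i) (b : ℤ)
    have hz2 := Int.emod_nonneg (z i) hb0.ne'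
    have hz3 := Int.emod_lt_of_pos (z i) hb0
    have hx2 := Int.emod_nonneg (x i) hb0.ne'
    have hx3 := Int.emod_lt_of_pos (x i) hb0
    rw [abs_le]
    constructor <;> nlinarith
  calc l1dist z x = ∑ i, |z i - x i| := rfl
    _ ≤ ∑ _i : Fin d, ((b : ℤ) - 1) := Finset.sum_le_sum fun i _ => hco i
    _ = (d : ℤ) * (b - 1) := by rw [Finset.sum_const, Finset.card_univ, Fintype.card_fin]; ring

/-! ## §3 The cutoffs of the two regions -/

/-- `h_A`: ramps from `0` to `1` as the depth into `□₁` goes from `2s` to `3s`. [cite: Balaban1984PropagatorsII, (2.47) p.231] -/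
def cutA (hd : 0 < d) (L : ℕ) (a : Fin d → ℤ) (M ρ k s : ℕ) (x : Fin d → ℤ) : ℝ :=
  ramp s (depth hd L a M ρ k 1 x - 2 * s)

/-- `h̃_A`: ramps from `0` to `1` as the depth into `□₁` goes from `s` to `2s` (`= 1` on the support of `h_A`). [cite: Balaban1984PropagatorsII, (2.48) p.231] -/
def cutAt (hd : 0 < d) (L : ℕ) (a : Fin d → ℤ) (M ρ k s : ℕ) (x : Fin d → ℤ) : ℝ :=
  ramp s (depth hd L a M ρ k 1 x - s)

open Classical in
/-- `h_B = 1 − h_A` on `□₀`, `0` off `□₀`. [cite: Balaban1984PropagatorsII, (2.47) p.231 («Σ_□ h_□² = 1»)] -/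
def cutB (hd : 0 < d) (L : ℕ) (a : Fin d → ℤ) (M ρ k s : ℕ) (x : Fin d → ℤ) : ℝ :=
  if x ∈ cube L a M ρ k 0 then 1 - cutA hd L a M ρ k s x else 0

open Classical in
/-- `h̃_B`: on `□₀`, ramps from `1` to `0` as the depth into `□₁` goes from `3s` to `4s` (`= 1` on the support of `h_B`); `0` off `□₀`.
[cite: Balaban1984PropagatorsII, (2.48) p.231] -/
def cutBt (hd : 0 < d) (L : ℕ) (a : Fin d → ℤ) (M ρ k s : ℕ) (x : Fin d → ℤ) : ℝ :=
  if x ∈ cube L a M ρ k 0 then ramp s (4 * s - depth hd L a M ρ k 1 x) else 0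

section Cutoffs

/-- Ranges: all four cutoffs take values in `[0, 1]`. [cite: Balaban1984PropagatorsII, (2.47) p.231] -/
theorem cut_mem (hd : 0 < d) (L : ℕ) (a : Fin d → ℤ) (M ρ k s : ℕ) (x : Fin d → ℤ) :
    (0 ≤ cutA hd L a M ρ k s x ∧ cutA hd L a M ρ k s x ≤ 1) ∧ (0 ≤ cutAt hd L a M ρ k s x ∧ cutAt hd L a M ρ k s x ≤ 1) ∧
    (0 ≤ cutB hd L a M ρ k s x ∧ cutB hd L a M ρ k s x ≤ 1) ∧ (0 ≤ cutBt hd L a M ρ k s x ∧ cutBt hd L a M ρ k s x ≤ 1) := by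
  refine ⟨ramp_mem _ _, ramp_mem _ _, ?_, ?_⟩
  · unfold cutB
    split_ifs
    · have h := ramp_mem s (depth hd L a M ρ k 1 x - 2 * s)
      unfold cutA
      constructor <;> linarith [h.1, h.2]
    · exact ⟨le_rfl, zero_le_one⟩
  · unfold cutBt
    split_ifs
    · exact ramp_mem _ _
    · exact ⟨le_rfl, zero_le_one⟩

/-- `h̃_A·h_A = h_A`. [cite: Balaban1984PropagatorsII, (2.48) p.231 («h̃_□h_□ = h_□»)] -/
theorem cutAt_mul_cutA (hd : 0 < d) (L : ℕ) (a : Fin d → ℤ) (M ρ k : ℕ) {s : ℕ} (hs : 1 ≤ s) (x : Fin d → ℤ) : cutAt hd L a M ρ k s x * cutA hd L a M ρ k s x = cutA hd L a M ρ k s x := by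
  by_cases h : cutA hd L a M ρ k s x = 0
  · rw [h, mul_zero]
  · have h1 : cutAt hd L a M ρ k s x = 1 := by
      unfold cutA at h
      unfold cutAt
      by_contra h2
      have hlt : depth hd L a M ρ k 1 x - s < s := by
        by_contra h3; push Not at h3; exact h2 (ramp_of_le hs h3)
      exact h (ramp_of_nonpos hs (by omega))
    rw [h1, one_mul]

/-- `h̃_B·h_B = h_B`. [cite: Balaban1984PropagatorsII, (2.48) p.231 («h̃_□h_□ = h_□»)] -/
theorem cutBt_mul_cutB (hd : 0 < d) (L : ℕ) (a : Fin d → ℤ) (M ρ k : ℕ) {s : ℕ} (hs : 1 ≤ s) (x : Fin d → ℤ) : cutBt hd L a M ρ k s x * cutB hd L a M ρ k s x = cutB hd L a M ρ k s x := by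
  classical
  by_cases h : cutB hd L a M ρ k s x = 0
  · rw [h, mul_zero]
  · have h1 : cutBt hd L a M ρ k s x = 1 := by
      unfold cutB at h
      unfold cutBt
      by_cases hx : x ∈ cube L a M ρ k 0
      · rw [if_pos hx] at h ⊢
        have h2 : cutA hd L a M ρ k s x ≠ 1 := fun h3 => h (by rw [h3, sub_self])
        unfold cutA at h2
        have hlt : depth hd L a M ρ k 1 x - 2 * s < s := by
          by_contra h3; push Not at h3; exact h2 (ramp_of_le hs h3)
        exact ramp_of_le hs (by omega)
      · rw [if_neg hx] at h; exact absurd rfl h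
    rw [h1, one_mul]

/-- `h_A + h_B = 1` on `□₀`. [cite: Balaban1984PropagatorsII, (2.47) p.231] -/
theorem cutA_add_cutB (hd : 0 < d) (L : ℕ) (a : Fin d → ℤ) (M ρ k s : ℕ) {x : Fin d → ℤ} (hx : x ∈ cube L a M ρ k 0) : cutA hd L a M ρ k s x + cutB hd L a M ρ k s x = 1 := by
  classical
  unfold cutB; rw [if_pos hx]; ring

/-- Off `□₁` the cutoffs `h_A, h̃_A` vanish; off `□₀` all four vanish. [cite: Balaban1984PropagatorsII, (2.47) p.231] -/
theorem cut_eq_zero_of_not_mem (hd : 0 < d) (L : ℕ) (a : Fin d → ℤ) (M ρ k : ℕ) {s : ℕ} (hs : 1 ≤ s) (hk : 1 ≤ k) {x : Fin d → ℤ} :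
    (x ∉ cube L a M ρ k 1 → cutA hd L a M ρ k s x = 0 ∧ cutAt hd L a M ρ k s x = 0) ∧
    (x ∉ cube L a M ρ k 0 → cutB hd L a M ρ k s x = 0 ∧ cutBt hd L a M ρ k s x = 0) := by
  classical
  constructor
  · intro hx
    rw [mem_cube_iff_one_le_depth hd a M ρ hk] at hx
    have h0 : depth hd L a M ρ k 1 x = 0 := le_antisymm (by omega) (depth_nonneg hd L a M ρ k 1 x)
    unfold cutA cutAt
    exact ⟨ramp_of_nonpos hs (by omega), ramp_of_nonpos hs (by omega)⟩
  · intro hx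
    unfold cutB cutBt
    exact ⟨by rw [if_neg hx], by rw [if_neg hx]⟩

/-- SUPPORT OF `h̃_A`: `h̃_A(x) ≠ 0 ⇒ depth₁(x) ≥ s + 1`, so `x` and all its neighbours lie in `□₁` (`s ≥ 1`, `k ≥ 1`).
[cite: Balaban1984PropagatorsII, (2.48) p.231] -/
theorem depth_of_cutAt_ne_zero (hd : 0 < d) (L : ℕ) (a : Fin d → ℤ) (M ρ k : ℕ) {s : ℕ} (hs : 1 ≤ s) (hk : 1 ≤ k) {x : Fin d → ℤ} (hx : cutAt hd L a M ρ k s x ≠ 0) :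
    (s : ℤ) + 1 ≤ depth hd L a M ρ k 1 x ∧ x ∈ cube L a M ρ k 1 ∧ ∀ μ, x + e μ ∈ cube L a M ρ k 1 ∧ x - e μ ∈ cube L a M ρ k 1 := by
  unfold cutAt at hx
  have h1 : (s : ℤ) + 1 ≤ depth hd L a M ρ k 1 x := by
    by_contra h; push Not at h; exact hx (ramp_of_nonpos hs (by omega))
  refine ⟨h1, (mem_cube_iff_one_le_depth hd a M ρ hk x).mpr (by omega), fun μ => ⟨?_, ?_⟩⟩
  · rw [mem_cube_iff_one_le_depth hd a M ρ hk]
    have := (abs_depth_sub_step_le hd L a M ρ k 1 x μ).1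
    rw [abs_le] at this; omega
  · rw [mem_cube_iff_one_le_depth hd a M ρ hk]
    have := (abs_depth_sub_step_le hd L a M ρ k 1 x μ).2
    rw [abs_le] at this; omega

/-- PLATEAU OF `h̃_A`: `depth₁(x) ≥ 2s ⇒ h̃_A(x) = 1`; below `s`: `h̃_A = 0`. [cite: Balaban1984PropagatorsII, (2.48) p.231] -/
theorem cutAt_eq_of_depth (hd : 0 < d) (L : ℕ) (a : Fin d → ℤ) (M ρ k : ℕ) {s : ℕ} (hs : 1 ≤ s) (x : Fin d → ℤ) :
    (2 * (s : ℤ) ≤ depth hd L a M ρ k 1 x → cutAt hd L a M ρ k s x = 1) ∧ (depth hd L a M ρ k 1 x ≤ s → cutAt hd L a M ρ k s x = 0) := by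
  unfold cutAt
  exact ⟨fun h => ramp_of_le hs (by omega), fun h => ramp_of_nonpos hs (by omega)⟩

/-- PLATEAUS OF `h_A`: `depth₁ ≥ 3s ⇒ h_A = 1`; `depth₁ ≤ 2s ⇒ h_A = 0`. [cite: Balaban1984PropagatorsII, (2.47) p.231] -/
theorem cutA_eq_of_depth (hd : 0 < d) (L : ℕ) (a : Fin d → ℤ) (M ρ k : ℕ) {s : ℕ} (hs : 1 ≤ s) (x : Fin d → ℤ) :
    (3 * (s : ℤ) ≤ depth hd L a M ρ k 1 x → cutA hd L a M ρ k s x = 1) ∧ (depth hd L a M ρ k 1 x ≤ 2 * s → cutA hd L a M ρ k s x = 0) := by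
  unfold cutA
  exact ⟨fun h => ramp_of_le hs (by omega), fun h => ramp_of_nonpos hs (by omega)⟩

/-- SUPPORT AND PLATEAUS OF `h̃_B`, `h_B` on `□₀`: `h̃_B(x) ≠ 0 ⇒ x ∈ □₀ ∧ depth₁(x) ≤ 4s − 1`; `depth₁ ≤ 3s ⇒ h̃_B = 1`; `depth₁ ≥ 4s ⇒ h̃_B = 0`;
`depth₁ ≥ 3s ⇒ h_B = 0`. [cite: Balaban1984PropagatorsII, (2.47)–(2.48) p.231] -/
theorem cutBt_facts (hd : 0 < d) (L : ℕ) (a : Fin d → ℤ) (M ρ k : ℕ) {s : ℕ} (hs : 1 ≤ s) (x : Fin d → ℤ) :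
    (cutBt hd L a M ρ k s x ≠ 0 → x ∈ cube L a M ρ k 0 ∧ depth hd L a M ρ k 1 x ≤ 4 * s - 1) ∧
    (x ∈ cube L a M ρ k 0 → depth hd L a M ρ k 1 x ≤ 3 * s → cutBt hd L a M ρ k s x = 1) ∧
    (4 * (s : ℤ) ≤ depth hd L a M ρ k 1 x → cutBt hd L a M ρ k s x = 0) ∧
    (3 * (s : ℤ) ≤ depth hd L a M ρ k 1 x → cutB hd L a M ρ k s x = 0) := by
  classical
  refine ⟨fun h => ?_, fun hx h => ?_, fun h => ?_, fun h => ?_⟩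
  · unfold cutBt at h
    by_cases hx : x ∈ cube L a M ρ k 0
    · rw [if_pos hx] at h
      refine ⟨hx, ?_⟩
      by_contra h2; push Not at h2
      exact h (ramp_of_nonpos hs (by omega))
    · rw [if_neg hx] at h; exact absurd rfl h
  · unfold cutBt; rw [if_pos hx]; exact ramp_of_le hs (by omega)
  · unfold cutBt; split_ifs
    · exact ramp_of_nonpos hs (by omega)
    · rfl
  · unfold cutB; split_ifs
    · rw [(cutA_eq_of_depth hd L a M ρ k hs x).1 h, sub_self]
    · rfl

/-- LIPSCHITZ: `|h(z) − h(x)| ≤ |z − x|₁ ∕ s` for `h = h_A, h̃_A` (all sites) and for `h = h_B, h̃_B` (sites of `□₀`).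
[cite: Balaban1984PropagatorsII, (2.48) p.231 («|∂h| ≤ O(1)(ML^jη)^{−1}»), (2.46) p.231] -/
theorem cut_lipschitz (hd : 0 < d) (L : ℕ) (a : Fin d → ℤ) (M ρ k : ℕ) {s : ℕ} (hs : 1 ≤ s) (z x : Fin d → ℤ) :
    |cutA hd L a M ρ k s z - cutA hd L a M ρ k s x| ≤ (l1dist z x : ℝ) / s ∧
    |cutAt hd L a M ρ k s z - cutAt hd L a M ρ k s x| ≤ (l1dist z x : ℝ) / s ∧
    (z ∈ cube L a M ρ k 0 → x ∈ cube L a M ρ k 0 →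
      |cutB hd L a M ρ k s z - cutB hd L a M ρ k s x| ≤ (l1dist z x : ℝ) / s ∧
      |cutBt hd L a M ρ k s z - cutBt hd L a M ρ k s x| ≤ (l1dist z x : ℝ) / s) := by
  classical
  have hs0 : (0 : ℝ) < s := by exact_mod_cast hs
  have hδ : |((depth hd L a M ρ k 1 z : ℤ) : ℝ) - (depth hd L a M ρ k 1 x : ℝ)| ≤ (l1dist z x : ℝ) := by
    exact_mod_cast abs_depth_sub_le_l1dist hd L a M ρ k 1 z x
  have key : ∀ (c : ℤ), |ramp s (depth hd L a M ρ k 1 z - c) - ramp s (depth hd L a M ρ k 1 x - c)| ≤ (l1dist z x : ℝ) / s := by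
    intro c
    refine le_trans (abs_ramp_sub_ramp_le hs _ _) (div_le_div_of_nonneg_right ?_ hs0.le)
    push_cast
    rw [show ((depth hd L a M ρ k 1 z : ℤ) : ℝ) - c - ((depth hd L a M ρ k 1 x : ℝ) - c)
      = (depth hd L a M ρ k 1 z : ℝ) - (depth hd L a M ρ k 1 x : ℝ) by ring]
    exact hδ
  have key' : |ramp s (4 * s - depth hd L a M ρ k 1 z) - ramp s (4 * s - depth hd L a M ρ k 1 x)| ≤ (l1dist z x : ℝ) / s := by
    refine le_trans (abs_ramp_sub_ramp_le hs _ _) (div_le_div_of_nonneg_right ?_ hs0.le)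
    push_cast
    rw [show (4 * (s : ℝ) - (depth hd L a M ρ k 1 z : ℝ)) - (4 * s - (depth hd L a M ρ k 1 x : ℝ))
      = -((depth hd L a M ρ k 1 z : ℝ) - (depth hd L a M ρ k 1 x : ℝ)) by ring, abs_neg]
    exact hδ
  refine ⟨?_, ?_, fun hz hx => ⟨?_, ?_⟩⟩
  · unfold cutA; exact_mod_cast key (2 * s)
  · unfold cutAt; exact_mod_cast key s
  · unfold cutB; rw [if_pos hz, if_pos hx]
    rw [show (1 - cutA hd L a M ρ k s z) - (1 - cutA hd L a M ρ k s x) = -(cutA hd L a M ρ k s z - cutA hd L a M ρ k s x) by ring, abs_neg]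
    unfold cutA; exact_mod_cast key (2 * s)
  · unfold cutBt; rw [if_pos hz, if_pos hx]; exact key'

end Cutoffs

/-! ## §4 The wall site set -/

open Classical in
/-- **THE WALL** `W = (□₀ ∖ □₁) ∪ {x ∈ □₀ : the L-block of x contains a site of depth₁ ≤ m_W}` — the level-0 collar together with the whole level-1
blocks near `∂□₁`; block-whole by construction. [cite: Balaban1984PropagatorsII, p.230 («□ … intersecting maybe the domain B^{j+1}(Λ_{j+1})»), (2.47) p.231; Balaban1985RegularSpaces, p.98] -/
def wall (hd : 0 < d) (L : ℕ) (a : Fin d → ℤ) (M ρ k : ℕ) (S : Finset (Fin d → ℤ)) (mW : ℕ) : Finset (Fin d → ℤ) :=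
  S.filter (fun x => x ∉ cube L a M ρ k 1 ∨ ∃ z ∈ S, blockMap L z = blockMap L x ∧ depth hd L a M ρ k 1 z ≤ mW)

section Wall

/-- `W ⊆ □₀`. [cite: Balaban1985RegularSpaces, p.98] -/
theorem wall_subset (hd : 0 < d) (L : ℕ) (a : Fin d → ℤ) (M ρ k : ℕ) (S : Finset (Fin d → ℤ)) (mW : ℕ) : wall hd L a M ρ k S mW ⊆ S := by
  classical
  exact Finset.filter_subset _ _

/-- Sites of `□₀` of depth₁ `≤ m_W` are in the wall. [cite: Balaban1985RegularSpaces, p.98] -/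
theorem mem_wall_of_depth_le (hd : 0 < d) (L : ℕ) (a : Fin d → ℤ) (M ρ k : ℕ) (S : Finset (Fin d → ℤ)) (mW : ℕ) {x : Fin d → ℤ} (hx : x ∈ S) (hδ : depth hd L a M ρ k 1 x ≤ mW) : x ∈ wall hd L a M ρ k S mW := by
  classical
  unfold wall
  rw [Finset.mem_filter]
  exact ⟨hx, Or.inr ⟨x, hx, rfl, hδ⟩⟩

/-- Sites of `□₀ ∖ □₁` are in the wall. [cite: Balaban1985RegularSpaces, p.98] -/
theorem mem_wall_of_not_mem (hd : 0 < d) (L : ℕ) (a : Fin d → ℤ) (M ρ k : ℕ) (S : Finset (Fin d → ℤ)) (mW : ℕ) {x : Fin d → ℤ} (hx : x ∈ S) (h1 : x ∉ cube L a M ρ k 1) : x ∈ wall hd L a M ρ k S mW := by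
  classical
  unfold wall
  rw [Finset.mem_filter]
  exact ⟨hx, Or.inl h1⟩

/-- A wall site inside `□₁` has depth₁ `≤ m_W + d(L − 1)`. [cite: Balaban1985RegularSpaces, p.98; Balaban1984PropagatorsII, (2.46) p.231] -/
theorem depth_le_of_mem_wall (hd : 0 < d) {L : ℕ} (hL : 1 ≤ L) (a : Fin d → ℤ) (M ρ k : ℕ) (S : Finset (Fin d → ℤ)) (mW : ℕ) {x : Fin d → ℤ} (hx : x ∈ wall hd L a M ρ k S mW) (h1 : x ∈ cube L a M ρ k 1) :
    depth hd L a M ρ k 1 x ≤ (mW : ℤ) + d * (L - 1) := by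
  classical
  unfold wall at hx
  rw [Finset.mem_filter] at hx
  rcases hx.2 with h | ⟨z, _, hzx, hz⟩
  · exact absurd h1 h
  · have hl := abs_depth_sub_le_l1dist hd L a M ρ k 1 x z
    have hb := l1dist_le_of_blockMap_eq hL hzx.symm
    rw [abs_le] at hl
    linarith [hl.2]

/-- The same-`L`-block closure: if `x ∈ W ∩ □₁` and `z ∈ □₀` shares the `L`-block of `x` and lies in `□₁`, then `z ∈ W`.
[cite: Balaban1985RegularSpaces, p.98 («□_j is a sum of the … blocks»)] -/
theorem mem_wall_of_blockMap_eq (hd : 0 < d) (L : ℕ) (a : Fin d → ℤ) (M ρ k : ℕ) (S : Finset (Fin d → ℤ)) (mW : ℕ) {x z : Fin d → ℤ} (hx : x ∈ wall hd L a M ρ k S mW) (hx1 : x ∈ cube L a M ρ k 1) (hz : z ∈ S)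
    (hzx : blockMap L z = blockMap L x) : z ∈ wall hd L a M ρ k S mW := by
  classical
  unfold wall at hx ⊢
  rw [Finset.mem_filter] at hx ⊢
  rcases hx.2 with h | ⟨z', hz'S, hz'x, hz'⟩
  · exact absurd hx1 h
  · exact ⟨hz, Or.inr ⟨z', hz'S, hz'x.trans hzx.symm, hz'⟩⟩

/-- A wall site is NOT in `□₂` once `m_W + d(L − 1) ≤ ρL` (`k ≥ 2`). [cite: Balaban1985RegularSpaces, p.98 («a distance between boundaries … R₁M₁Lʲη»)] -/
theorem not_mem_cube_two_of_mem_wall (hd : 0 < d) {L : ℕ} (hL : 1 ≤ L) (a : Fin d → ℤ) (M ρ k : ℕ) (S : Finset (Fin d → ℤ)) (mW : ℕ) (hk : 2 ≤ k) (hmW : (mW : ℤ) + d * (L - 1) ≤ ρ * L) {x : Fin d → ℤ}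
    (hx : x ∈ wall hd L a M ρ k S mW) : x ∉ cube L a M ρ k 2 := by
  intro h2
  have hge := depth_ge_of_mem_inner hd a M ρ (show 1 < 2 by norm_num) hk h2
  rw [pow_one] at hge
  have h1 : x ∈ cube L a M ρ k 1 :=
    B8Eq131Cubes.cube_succ_subset (L := L) (a := a) (M := M) (ρ := ρ) (show 1 < k by omega) h2
  have hle := depth_le_of_mem_wall hd hL a M ρ k S mW hx h1
  linarith

end Wall

/-! ## §5 The wall carries the tower structure of the cube member, with levels `≤ 1` -/

section WallTowers

open B8CubeMemberZd (cubeLamS)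
open B8Eq131CubesAdmissible (cubeFam cubeFam_false_of_le)
open B8Eq191FlatDirichletCoercive (towerBlock_subset_cube)
open B8Eq191FlatLettersCubeMember (towers_disjoint_cube)
open B8Eq191FlatDirichletConjugation (cover_cubeMember)
open B8Eq191FlatDirichletDepth (mem_cube_of_tower mem_cube_of_le_tower)

/-- `blockMap (L⁰) = id`. [folklore] [cite: Balaban1985RegularSpaces, p.79] -/
theorem blockMap_pow_zero (L : ℕ) (z : Fin d → ℤ) : blockMap (L ^ 0) z = z := by
  funext i; simp [blockMap]

/-- LEVELS ON THE WALL ARE `≤ 1` (when `m_W + d(L − 1) ≤ ρL`): a wall site at tower level `j` of the truncation-`n` towers has `j ≤ 1`.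
[cite: Balaban1985RegularSpaces, p.98, (1.131) p.99] -/
theorem wall_level_le_one (hd : 0 < d) {L : ℕ} (hL : 1 ≤ L) (a : Fin d → ℤ) (M : ℕ) {ρ : ℕ} (hρ : L ≤ ρ) {k n : ℕ} (hn : n ≤ k)
    (S : Finset (Fin d → ℤ)) (mW : ℕ) (hmW : (mW : ℤ) + d * (L - 1) ≤ ρ * L) {x : Fin d → ℤ} (hx : x ∈ wall hd L a M ρ k S mW)
    {j : ℕ} (hj : j ≤ n) (hxj : blockMap (L ^ j) x ∈ cubeLamS L a M ρ k n j) : j ≤ 1 := by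
  by_contra h
  push Not at h
  have hk : 2 ≤ k := le_trans (le_trans h hj) hn
  have h2 : x ∈ cube L a M ρ k 2 := mem_cube_of_le_tower hL a M hρ hn hj h hxj
  exact not_mem_cube_two_of_mem_wall hd hL a M ρ k S mW hk hmW hx h2

/-- `hfull` FOR THE WALL: live tower blocks of wall sites lie in the wall. [cite: Balaban1985RegularSpaces, p.98, (1.5)–(1.6) p.77] -/
theorem wall_hfull (hd : 0 < d) {L : ℕ} (hL : 1 ≤ L) (a : Fin d → ℤ) (M : ℕ) {ρ : ℕ} (hρ : L ≤ ρ) {k n : ℕ} (hn : n ≤ k)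
    (S : Finset (Fin d → ℤ)) (hS : ∀ x, x ∈ S ↔ x ∈ cubeFam false L a M ρ k 0) (mW : ℕ) (hmW : (mW : ℤ) + d * (L - 1) ≤ ρ * L) :
    ∀ j, j ≤ n → ∀ x ∈ wall hd L a M ρ k S mW, blockMap (L ^ j) x ∈ cubeLamS L a M ρ k n j →
      ∀ z, blockMap (L ^ j) z = blockMap (L ^ j) x → z ∈ wall hd L a M ρ k S mW := by
  intro j hj x hx hxj z hz
  have hj1 := wall_level_le_one hd hL a M hρ hn S mW hmW hx hj hxj
  have hzS : z ∈ S := (hS z).mpr (towerBlock_subset_cube hL a M hρ hn hj hxj hz)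
  rcases Nat.le_one_iff_eq_zero_or_eq_one.mp hj1 with h0 | h1
  · subst h0
    rw [blockMap_pow_zero, blockMap_pow_zero] at hz
    rw [hz]; exact hx
  · subst h1
    have hx1 : x ∈ cube L a M ρ k 1 := mem_cube_of_tower hL a M ρ hxj
    have hz1 : z ∈ cube L a M ρ k 1 := mem_cube_of_tower hL a M ρ (by rw [hz]; exact hxj)
    have hz' : blockMap L z = blockMap L x := by rw [← pow_one L]; exact hz
    exact mem_wall_of_blockMap_eq hd L a M ρ k S mW hx hx1 hzS hz'

/-- `hdisj` FOR THE WALL (one level per site), inherited from `□₀`. [cite: Balaban1985RegularSpaces, (1.5)–(1.6) p.77, (1.131) p.99] -/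
theorem wall_hdisj (hd : 0 < d) {L : ℕ} (hL : 1 ≤ L) (a : Fin d → ℤ) (M : ℕ) {ρ : ℕ} (hρ : L ≤ ρ) {k n : ℕ} (hn : n ≤ k)
    (S : Finset (Fin d → ℤ)) (hS : ∀ x, x ∈ S ↔ x ∈ cubeFam false L a M ρ k 0) (mW : ℕ) :
    ∀ x ∈ wall hd L a M ρ k S mW, ∀ j, j ≤ n → ∀ j', j' ≤ n →
      blockMap (L ^ j) x ∈ cubeLamS L a M ρ k n j → blockMap (L ^ j') x ∈ cubeLamS L a M ρ k n j' → j = j' := by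
  intro x hx j hj j' hj' h1 h2
  have hxS : x ∈ S := wall_subset hd L a M ρ k S mW hx
  exact (towers_disjoint_cube hL a M hρ hn j hj j' hj' _ h1 _ h2 x ((hS x).mp hxS) rfl rfl).1

/-- `hcover` FOR THE WALL (every site lies in a tower), inherited from `□₀`. [cite: Balaban1985RegularSpaces, (1.5)–(1.6) p.77, (1.131) p.99] -/
theorem wall_hcover (hd : 0 < d) {L : ℕ} (hL : 1 ≤ L) (a : Fin d → ℤ) (M : ℕ) {ρ : ℕ} (hρ : L ≤ ρ) {k n : ℕ} (hn : n ≤ k)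
    (S : Finset (Fin d → ℤ)) (hS : ∀ x, x ∈ S ↔ x ∈ cubeFam false L a M ρ k 0) (mW : ℕ) :
    ∀ x ∈ wall hd L a M ρ k S mW, ∃ j, j ≤ n ∧ blockMap (L ^ j) x ∈ cubeLamS L a M ρ k n j := by
  intro x hx
  exact cover_cubeMember hL a M hρ hn x ((hS x).mp (wall_subset hd L a M ρ k S mW hx))

/-- `hlow` FOR THE WALL. [cite: Balaban1985RegularSpaces, p.98] -/
theorem wall_hlow (hd : 0 < d) {L : ℕ} (hL : 1 ≤ L) (a : Fin d → ℤ) (M : ℕ) {ρ : ℕ} (hρ : L ≤ ρ) {k n : ℕ} (hn : n ≤ k)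
    (S : Finset (Fin d → ℤ)) (mW : ℕ) (hmW : (mW : ℤ) + d * (L - 1) ≤ ρ * L) :
    ∀ x ∈ wall hd L a M ρ k S mW, ∀ j, j ≤ n → blockMap (L ^ j) x ∈ cubeLamS L a M ρ k n j → j ≤ 1 :=
  fun _ hx _ hj hxj => wall_level_le_one hd hL a M hρ hn S mW hmW hx hj hxj

/-- THE ROW OF A NEAR-WALL SITE SEES ONLY THE WALL: if `x ∈ □₀` has depth₁ `≤ m_W − 1`, then `x ∈ W`, every neighbour of `x` in `□₀` is in `W`, and so is
every site of the live tower block of `x`. [cite: Balaban1985RegularSpaces, p.98; Balaban1984PropagatorsII, (2.48) p.231] -/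
theorem wall_row (hd : 0 < d) {L : ℕ} (hL : 1 ≤ L) (a : Fin d → ℤ) (M : ℕ) {ρ : ℕ} (hρ : L ≤ ρ) {k n : ℕ} (hn : n ≤ k)
    (S : Finset (Fin d → ℤ)) (hS : ∀ x, x ∈ S ↔ x ∈ cubeFam false L a M ρ k 0) (mW : ℕ) (hmW : (mW : ℤ) + d * (L - 1) ≤ ρ * L)
    {x : Fin d → ℤ} (hx : x ∈ S) (hδ : depth hd L a M ρ k 1 x + 1 ≤ mW) :
    x ∈ wall hd L a M ρ k S mW ∧
    (∀ μ, (x + e μ ∈ S → x + e μ ∈ wall hd L a M ρ k S mW) ∧ (x - e μ ∈ S → x - e μ ∈ wall hd L a M ρ k S mW)) ∧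
    (∀ j, j ≤ n → blockMap (L ^ j) x ∈ cubeLamS L a M ρ k n j → ∀ z, blockMap (L ^ j) z = blockMap (L ^ j) x → z ∈ wall hd L a M ρ k S mW) := by
  have hxW : x ∈ wall hd L a M ρ k S mW := mem_wall_of_depth_le hd L a M ρ k S mW hx (by omega)
  refine ⟨hxW, fun μ => ⟨fun h => ?_, fun h => ?_⟩, fun j hj hxj z hz => wall_hfull hd hL a M hρ hn S hS mW hmW j hj x hxW hxj z hz⟩
  · have := (abs_depth_sub_step_le hd L a M ρ k 1 x μ).1
    rw [abs_le] at this
    exact mem_wall_of_depth_le hd L a M ρ k S mW h (by omega)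
  · have := (abs_depth_sub_step_le hd L a M ρ k 1 x μ).2
    rw [abs_le] at this
    exact mem_wall_of_depth_le hd L a M ρ k S mW h (by omega)

end WallTowers

end Literature.MathematicalPhysics.QuantumFieldTheory.Balaban1983to89.B8Eq1101CubeMemberCutoffs
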